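import Mathlib.LinearAlgebra.Matrix.Rank
import Mathlib.LinearAlgebra.LinearIndependent.Lemmas
import Summits.ValiantsHypothesis.ValiantsHypothesis.Theorems.GrenetZeonHessianRankCodimTwoBlockEigen
import Summits.ValiantsHypothesis.ValiantsHypothesis.Theorems.GrenetZeonHessianRankCodimTwoLatinPlaneDefs
import HarnessLib

/-!
# Crux `GrenetZeon.HessianRankCodimTwo` (stmt-ValiantsHypothesis-8061), line `good_plane`:
# `stub_goodPlanes` REDUCED to the Latin block non-vanishing (★)

Main results (seat val-width-8061-p2, 2026-08-27):

* `goodPlane_of_latinBlockNonvanishing` — for `m ≥ 12`, `r < 3`, `n = 3m + r`: if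
  `LatinBlockNonvanishing m r` holds (at every point of the Latin block plane on `per_n = 0` at
  least six of the nine block values are non-zero), then the three matrices `latinBasis m r` form a
  GOOD PLANE — the statement `GoodPlane (3m + r)` of `Lines/good_plane.lean`, unfolded.  Proof: the
  rows (columns) of a point of the plane inside each big block coincide
  (`latinPoint_row_congr`, `latinPoint_col_congr`), so the block-eigenvector rank bound
  `le_rank_hessPer_of_blocks` (file `…BlockEigen`) gives `rank Hess per_n ≥ 6 (m-1)²`, and
  `12 (m-1)² > (3m+2)²` for `m ≥ 12`.
* `goodPlanes_of_latinBlockNonvanishing` — (★) for all large `m` and all `r < 3` implies the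
  registered stub `stub_goodPlanes : ∃ n₀, ∀ n ≥ n₀, GoodPlane n` (unfolded; `n₀ = 3·max(m₀,12)`).
* `linearIndependent_latinBasis` — the three basis matrices are independent.

So the line `good_plane` now rests on (★) alone (`stub_planeCriterion` is
`Theorems/GrenetZeonHessianRankCodimTwoPlaneCriterion.lean`).  (★) is an explicit statement about
common zeros, on a plane curve of degree `n`, of nine sub-permanent polynomials of degree `n - 2`
in three homogeneous variables; verified by exact elimination for small `m` (see the Defs file),
open uniformly in `m`.  VP ≠ VNP is not moved by anything here.
-/

noncomputable section

open Matrix Finset MvPolynomial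
open Literature.Computability.AlgebraicComplexity

-- single-conjunct layout `Summits/ValiantsHypothesis/ValiantsHypothesis`: duplicated namespace by design
set_option linter.dupNamespace false

namespace Summit.ValiantsHypothesis.ValiantsHypothesis.Theorems.GrenetZeonHessianRankCodimTwo

section Basis

variable {m r : ℕ}

/-- Entries of the basis matrices in the big blocks. [folklore] -/
theorem latinBasis_apply_big (d : Fin 3) {i j : Fin (3 * m + r)} (hi : i.val < 3 * m)
    (hj : j.val < 3 * m) :
    latinBasis m r d (i, j) = if (i.val / m + d.val) % 3 = j.val / m then 1 else 0 := by
  simp only [latinBasis, hi, hj, if_true]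

/-- The basis matrices only see a big row through its block. [folklore] -/
theorem latinBasis_row_congr (d : Fin 3) {i i' : Fin (3 * m + r)} (hi : i.val < 3 * m)
    (hi' : i'.val < 3 * m) (h : i.val / m = i'.val / m) (j : Fin (3 * m + r)) :
    latinBasis m r d (i, j) = latinBasis m r d (i', j) := by
  simp only [latinBasis, hi, hi', if_true, h]

/-- The basis matrices only see a big column through its block. [folklore] -/
theorem latinBasis_col_congr (d : Fin 3) {j j' : Fin (3 * m + r)} (hj : j.val < 3 * m)
    (hj' : j'.val < 3 * m) (h : j.val / m = j'.val / m) (i : Fin (3 * m + r)) :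
    latinBasis m r d (i, j) = latinBasis m r d (i, j') := by
  simp only [latinBasis, hj, hj', if_true, h]

/-- Entries of a point of the plane. [folklore] -/
theorem latinPoint_apply (a : Fin 3 → ℂ) (p : Fin (3 * m + r) × Fin (3 * m + r)) :
    latinPoint m r a p = ∑ d, a d * latinBasis m r d p := by
  simp only [latinPoint, Finset.sum_apply, Pi.smul_apply, smul_eq_mul]

/-- Rows of a big block of a point of the plane coincide. [folklore] -/
theorem latinPoint_row_congr (a : Fin 3 → ℂ) {i i' : Fin (3 * m + r)} (hi : i.val < 3 * m)
    (hi' : i'.val < 3 * m) (h : i.val / m = i'.val / m) (j : Fin (3 * m + r)) :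
    latinPoint m r a (i, j) = latinPoint m r a (i', j) := by
  simp only [latinPoint_apply, latinBasis_row_congr _ hi hi' h]

/-- Columns of a big block of a point of the plane coincide. [folklore] -/
theorem latinPoint_col_congr (a : Fin 3 → ℂ) {j j' : Fin (3 * m + r)} (hj : j.val < 3 * m)
    (hj' : j'.val < 3 * m) (h : j.val / m = j'.val / m) (i : Fin (3 * m + r)) :
    latinPoint m r a (i, j) = latinPoint m r a (i, j') := by
  simp only [latinPoint_apply, latinBasis_col_congr _ hj hj' h]

/-- The three basis matrices are linearly independent (`m ≥ 1`). [folklore] -/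
theorem linearIndependent_latinBasis (hm : 1 ≤ m) : LinearIndependent ℂ (latinBasis m r) := by
  rw [Fintype.linearIndependent_iff]
  intro g hg d
  -- evaluate at row `0`, column `d·m`
  have h0 : (0 : ℕ) < 3 * m + r := by omega
  have hd : d.val * m < 3 * m + r := by have := d.isLt; nlinarith
  have key := congr_fun hg (⟨0, h0⟩, ⟨d.val * m, hd⟩)
  simp only [Finset.sum_apply, Pi.smul_apply, smul_eq_mul, Pi.zero_apply] at key
  have hval : ∀ d' : Fin 3, latinBasis m r d' (⟨0, h0⟩, ⟨d.val * m, hd⟩) =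
      if d' = d then 1 else 0 := by
    intro d'
    have h1 : (0 : ℕ) < 3 * m := by omega
    have h2 : d.val * m < 3 * m := by have := d.isLt; nlinarith
    rw [latinBasis_apply_big d' h1 h2]
    simp only [Nat.zero_div, zero_add, Nat.mul_div_cancel _ (by omega : 0 < m),
      Nat.mod_eq_of_lt d'.isLt, Fin.val_eq_val]
  simp only [hval, mul_ite, mul_one, mul_zero, Finset.sum_ite_eq', Finset.mem_univ, if_true] at key
  exact key

end Basis

section Blocks

variable {m r : ℕ}

/-- The rows (= columns) of big block `I`. [folklore] -/
theorem card_blockRows_ge (hm : 2 ≤ m) (I : Fin 3) :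
    m ≤ (Finset.univ.filter fun i : Fin (3 * m + r) => i.val < 3 * m ∧ i.val / m = I.val).card := by
  have hI := I.isLt
  let f : Fin m → Fin (3 * m + r) := fun s => ⟨I.val * m + s.val, by have := s.isLt; nlinarith⟩
  have hf : Function.Injective f := by
    intro s s' h
    have := congr_arg Fin.val h
    simp only [f] at this
    exact Fin.ext (by omega)
  calc m = (Finset.univ.image f).card := by
        rw [Finset.card_image_of_injective _ hf, Finset.card_univ, Fintype.card_fin]
    _ ≤ _ := by
        refine Finset.card_le_card fun i hi => ?_
        obtain ⟨s, -, rfl⟩ := Finset.mem_image.1 hi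
        simp only [Finset.mem_filter, Finset.mem_univ, true_and, f]
        refine ⟨by have := s.isLt; nlinarith, ?_⟩
        rw [show I.val * m + s.val = s.val + m * I.val by ring, Nat.add_mul_div_left _ _ (by omega),
          Nat.div_eq_of_lt s.isLt, zero_add]

/-- Membership of the representative indices in their block. [folklore] -/
theorem blockIdx_mem (hm : 2 ≤ m) (I : Fin 3) (s : Fin 2) :
    blockIdx m r hm I s ∈
      (Finset.univ.filter fun i : Fin (3 * m + r) => i.val < 3 * m ∧ i.val / m = I.val) := by
  have hI := I.isLt
  have hs := s.isLt
  simp only [Finset.mem_filter, Finset.mem_univ, true_and, blockIdx]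
  refine ⟨by nlinarith, ?_⟩
  rw [show I.val * m + s.val = s.val + m * I.val by ring, Nat.add_mul_div_left _ _ (by omega),
    Nat.div_eq_of_lt (by omega), zero_add]

/-- The two representatives of a block are distinct. [folklore] -/
theorem blockIdx_zero_ne_one (hm : 2 ≤ m) (I : Fin 3) :
    blockIdx m r hm I 0 ≠ blockIdx m r hm I 1 := by
  intro h
  have := congr_arg Fin.val h
  simp [blockIdx] at this

end Blocks

section Main

variable {m r : ℕ}

/-- **The Latin block plane is good, given (★).** For `m ≥ 12`, `r ≤ 2` and `n = 3m + r`: if at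
every point of the plane on the permanental hypersurface at least six block values are non-zero,
then the Hessian of `per_n` there has rank `≥ 6(m-1)² > n²/2`, so the three basis matrices form a
GOOD PLANE in the sense of line `good_plane` (the statement is `GoodPlane (3m+r)` unfolded).
[folklore] -/
theorem goodPlane_of_latinBlockNonvanishing (hm : 12 ≤ m) (hr : r < 3)
    (h : LatinBlockNonvanishing m r) :
    ∃ w : Fin 3 → (Fin (3 * m + r) × Fin (3 * m + r) → ℂ), LinearIndependent ℂ w ∧
      ∀ a : Fin 3 → ℂ, a ≠ 0 →
        MvPolynomial.eval (∑ i, a i • w i) (perPoly (Fin (3 * m + r)) ℂ) = 0 →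
        (3 * m + r) ^ 2 <
          2 * (hess0 (transl (∑ i, a i • w i) (perPoly (Fin (3 * m + r)) ℂ))).rank := by
  classical
  have hm2 : 2 ≤ m := by omega
  refine ⟨latinBasis m r, linearIndependent_latinBasis (by omega), ?_⟩
  intro a ha hper
  change MvPolynomial.eval (latinPoint m r a) _ = 0 at hper
  change _ < 2 * (hess0 (transl (latinPoint m r a) (perPoly (Fin (3 * m + r)) ℂ))).rank
  have h6 := h hm2 a ha hper
  -- the family of blocks with non-zero value
  set T := Finset.univ.filter fun IJ : Fin 3 × Fin 3 => latinBlockValue m r hm2 a IJ.1 IJ.2 ≠ 0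
    with hT
  set rows : Fin 3 → Finset (Fin (3 * m + r)) :=
    fun I => Finset.univ.filter fun i : Fin (3 * m + r) => i.val < 3 * m ∧ i.val / m = I.val
    with hrows
  have hbound := le_rank_hessPer_of_blocks (ι := T) (latinPoint m r a)
    (fun t => rows t.1.1) (fun t => rows t.1.2)
    (fun t i hi i' hi' j => by
      simp only [hrows, Finset.mem_filter, Finset.mem_univ, true_and] at hi hi'
      exact latinPoint_row_congr a hi.1 hi'.1 (hi.2.trans hi'.2.symm) j)
    (fun t j hj j' hj' i => by
      simp only [hrows, Finset.mem_filter, Finset.mem_univ, true_and] at hj hj'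
      exact latinPoint_col_congr a hj.1 hj'.1 (hj.2.trans hj'.2.symm) i)
    (fun t t' p h1 h2 h1' h2' => by
      simp only [hrows, Finset.mem_filter, Finset.mem_univ, true_and] at h1 h2 h1' h2'
      apply Subtype.ext
      exact Prod.ext (Fin.ext (h1.2.symm.trans h1'.2)) (Fin.ext (h2.2.symm.trans h2'.2)))
    (fun t => blockIdx m r hm2 t.1.1 0) (fun t => blockIdx m r hm2 t.1.1 1)
    (fun t => blockIdx m r hm2 t.1.2 0) (fun t => blockIdx m r hm2 t.1.2 1)
    (fun t => blockIdx_mem hm2 _ _) (fun t => blockIdx_mem hm2 _ _)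
    (fun t => blockIdx_zero_ne_one hm2 _)
    (fun t => blockIdx_mem hm2 _ _) (fun t => blockIdx_mem hm2 _ _)
    (fun t => blockIdx_zero_ne_one hm2 _)
    (fun t => by
      have := t.2
      simp only [hT, Finset.mem_filter, Finset.mem_univ, true_and] at this
      exact this)
  -- count: `6 (m-1)² ≤ Σ_t (|I_t| - 1)(|J_t| - 1)`
  have hcnt : 6 * ((m - 1) * (m - 1)) ≤
      ∑ t : T, ((rows t.1.1).card - 1) * ((rows t.1.2).card - 1) := by
    have hle : ∀ t : T, (m - 1) * (m - 1) ≤ ((rows t.1.1).card - 1) * ((rows t.1.2).card - 1) :=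
      fun t => Nat.mul_le_mul (Nat.sub_le_sub_right (card_blockRows_ge hm2 _) 1)
        (Nat.sub_le_sub_right (card_blockRows_ge hm2 _) 1)
    calc 6 * ((m - 1) * (m - 1)) ≤ T.card * ((m - 1) * (m - 1)) := Nat.mul_le_mul_right _ h6
      _ = ∑ _t : T, (m - 1) * (m - 1) := by
          rw [Finset.sum_const, Finset.card_univ, Fintype.card_coe, smul_eq_mul]
      _ ≤ _ := Finset.sum_le_sum fun t _ => hle t
  have harith : (3 * m + r) ^ 2 < 2 * (6 * ((m - 1) * (m - 1))) := by
    obtain ⟨k, rfl⟩ : ∃ k, m = k + 12 := ⟨m - 12, by omega⟩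
    rw [show k + 12 - 1 = k + 11 by omega]
    nlinarith
  calc (3 * m + r) ^ 2 < 2 * (6 * ((m - 1) * (m - 1))) := harith
    _ ≤ 2 * _ := Nat.mul_le_mul_left 2 (hcnt.trans hbound)

/-- **`stub_goodPlanes` from (★).** If the Latin block non-vanishing holds for all large `m` and
all `r < 3`, then good planes exist for all large `n` — the registered stub `stub_goodPlanes` of
line `good_plane` (`∃ n₀, ∀ n ≥ n₀, GoodPlane n`, unfolded). [folklore] -/
theorem goodPlanes_of_latinBlockNonvanishing
    (h : ∃ m₀ : ℕ, ∀ m ≥ m₀, ∀ r < 3, LatinBlockNonvanishing m r) :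
    ∃ n₀ : ℕ, ∀ n ≥ n₀, ∃ w : Fin 3 → (Fin n × Fin n → ℂ), LinearIndependent ℂ w ∧
      ∀ a : Fin 3 → ℂ, a ≠ 0 → MvPolynomial.eval (∑ i, a i • w i) (perPoly (Fin n) ℂ) = 0 →
        n ^ 2 < 2 * (hess0 (transl (∑ i, a i • w i) (perPoly (Fin n) ℂ))).rank := by
  obtain ⟨m₀, hm₀⟩ := h
  refine ⟨3 * max m₀ 12, fun n hn => ?_⟩
  obtain ⟨m, r, hr, rfl⟩ : ∃ m r, r < 3 ∧ n = 3 * m + r :=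
    ⟨n / 3, n % 3, Nat.mod_lt _ (by norm_num), (Nat.div_add_mod n 3).symm⟩
  have hm : max m₀ 12 ≤ m := by omega
  exact goodPlane_of_latinBlockNonvanishing (le_of_max_le_right hm) hr
    (hm₀ m (le_of_max_le_left hm) r hr)

end Main

end Summit.ValiantsHypothesis.ValiantsHypothesis.Theorems.GrenetZeonHessianRankCodimTwo
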